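import Summits.BirchSwinnertonDyer.BirchSwinnertonDyer.Theorems.GoldfeldAllTwistsTwoConverseTwinHalfTraceSevenModEightCore
import Summits.BirchSwinnertonDyer.BirchSwinnertonDyer.Theorems.GoldfeldAllTwistsTwoConverseTwinGenusPartnerNegPrime
import Summits.BirchSwinnertonDyer.BirchSwinnertonDyer.Theorems.GoldfeldAllTwistsTwoConverseTwinGenusFieldDescent
import Summits.BirchSwinnertonDyer.BirchSwinnertonDyer.Theorems.GoldfeldAllTwistsTwoConverseTwinGenusHeightRatioNegTwo
import Literature.NumberTheory.EllipticCurves.HeegnerPointsGenusHalfTraceProofs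
import Literature.NumberTheory.EllipticCurves.HeegnerPointsRationalityProofs
import Literature.NumberTheory.EllipticCurves.HeegnerPointsClassNumberProofs
import Literature.NumberTheory.EllipticCurves.HeegnerPointsClassesProofs
import Literature.NumberTheory.EllipticCurves.HeegnerPointsProofs
import Literature.NumberTheory.EllipticCurves.HeegnerPointsImaginaryQuadraticProofs
import Literature.NumberTheory.EllipticCurves.HeegnerPointReflectionProofs
import Literature.NumberTheory.EllipticCurves.CuspFormLValueSeries
import HarnessLib

set_option linter.dupNamespace false
set_option autoImplicit false

/-!
# LINE B49, family F3 (`d_K = −8ℓ`): the PARTNER POINT `Y_ℓ = y_{K₂}`, `K₂ = ℚ(√−ℓ) ⊂ K[1]` — Birch's relation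
# `Y + Ȳ = T` EXACTLY, and the Galois behaviour of `Y` in `X₀(49)(K[1])` (hypotheses (H2)–(H4) of the assembly)

Cell `bsd-goldfeld`, seat `bsd-goldfeld-s1p-c3x` (prover, gen 0; second lane on item `stmt-BirchSwinnertonDyer-19350`, instruction
of record `HOME/LANE-BRIEF-S1P-C3X.md` §2 file 4, Birch half), `--supports stmt-BirchSwinnertonDyer-19350`. Theses-free; theorems
only; NO new definition, NO new fact. HONEST FRAMING: BSD is not proved here. The two named inputs are bound BY NAME / in the tree's
verbatim shape: the root number `w(49a1) = +1` (`hw : cm7.rootNumber = 1`, = `rootNumber_cm7 h12`) and the cusp value (T-φ0)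
`φ₀(0) = T` (`h0 : Odd D₀.c → ∃ h, D₀.cuspZeroPoint = (2, −1)`, = the named input `x049_cuspZeroPoint_eq_twoTorsion` of
`Literature/NumberTheory/EllipticCurves/X049CuspZeroTwoTorsion.lean`, discharged given `h12` by seat c3's
`x049_cuspZeroPoint_eq_twoTorsion_holds_of_thm12`, p534836). Everything else is a theorem of the tree.

## Content

§1 **Birch's relation, EXACT form.** For an imaginary quadratic `F` with the Heegner hypothesis for `N = N(49a1) = 49`, a
parametrisation datum `D₀`, a Heegner datum `H` and `P ∈ X₀(49)(F)` over the traced Heegner point `Σ_Q φ(τ_Q) ∈ E(ℂ)`: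
`ι(σP + P) = h_F · φ(0)` for the non-trivial automorphism `σ` of `F` — the summed reflection law of ty's FILE D
(`conjPoint_sum_φ_heegnerTau_filter`, all classes, Fricke sign `−w = −1` from `isFrickeEigen_neg_one_of_rootNumber_eq_one`)
and `ι ∘ σ = conj ∘ ι` (`comp_eq_conjugate_of_ne_id`). With `h_F` odd and `φ(0) = T`: **`σP + P = T`** in `X₀(49)(F)`
(`cm7_heegnerPoint_conj_add_eq_twoTorsion`; injectivity of `E(F) → E(ℂ)`).

§2 **The partner field inside `K[1]`.** For `d_K = −8ℓ`, `ℓ ≡ 3 (mod 4)` prime, and `r₀ ∈ K[1] = H_K` with `r₀² = −ℓ`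
(genus theory, `sqrt_primeStar_mem_ringClassField_one`), `K₂ := ℚ⟮r₀⟯ ⊂ K[1]` is imaginary quadratic of discriminant `−ℓ`
(`finrank_adjoin_sqrt_eq_two`, `IsImaginaryQuadratic.of_quadratic`, `discr_eq_neg_prime_of_sq_eq`), `h(−ℓ)` is odd
(`odd_classNumber_of_sq_eq_neg_prime`), `7` splits in `K₂` (`(−ℓ/7) = +1`), so `X₀(49)` has a Heegner point `P₂ ∈ X₀(49)(K₂)`
(`heegnerPointComplex_mem_range_map_holds`, Darmon Thm 3.6, PROVED in the tree). Its image `Y := P₂ ∈ X₀(49)(K[1])` satisfies: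
every `ℚ`-algebra map `t : K[1] → K[1]` FIXING `r₀` fixes `Y` (`IntermediateField.adjoin_algHom_ext`), and every `t` with
`t r₀ = −r₀` restricts to `σ` on `K₂`, whence **`Y + tY = T`** (§1). Complex conjugation has `conj r₀ = −r₀`
(`conj_eq_neg_of_sq_eq_neg`), so this covers (H2) `Y + τY = T`, (H3) and (H4) of
`not_isOfFinAddOrder_trace_of_halfTraceData_negEightPrime` at once (`exists_partnerPoint_negEightPrime`).

References: B. Birch, *Heegner points of elliptic curves*, Symp. Math. 15 (1975) §3; B. Gross, *Heegner points on X₀(N)* (1984)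
§5 (5.2)–(5.3) [Gross1984]; B. Gross, in *L-functions and Arithmetic*, LMS LN 153 (1991) Prop. 5.3 [GrossLMS1991]; H. Darmon,
CBMS 101 (2004) Thm 3.6, Prop. 3.11 [Darmon2004]; D. Cox, *Primes of the form x² + ny²* (2013) Thm 6.1 [Cox2013].
-/

noncomputable section

open scoped Classical IntermediateField

open WeierstrassCurve Literature.NumberTheory.EllipticCurves Literature.NumberTheory.EllipticCurves.ModularForms
  Literature.NumberTheory.EllipticCurves.CoatesLiTianZhai2015

namespace Summit.BirchSwinnertonDyer.BirchSwinnertonDyer.Theorems.GoldfeldGoodTwists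

/-! ## §1 Birch's relation `σP + P = h·φ(0) = T` over an imaginary quadratic field -/

section Birch

variable {F : Type} [Field F] [NumberField F]

/-- **Birch's relation in `E(ℂ)`, exact**: for `X₀(49)` (root number `+1`, so Fricke sign `−1` on `f`), an imaginary
quadratic `F` with the Heegner hypothesis, and `P ∈ X₀(49)(F)` over `y = Σ_Q φ(τ_Q)`: `ι(σP + P) = h_F · φ(0)` for the
non-trivial `σ ∈ Gal(F/ℚ)` (`conj y = −y + h·φ(0)`, ty's summed law over all classes, and `ι∘σ = conj∘ι`).
[cite: GrossLMS1991, Prop. 5.3 and proof (PDF p. 220)] [cite: Darmon2004, Prop. 3.11] -/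
theorem map_cm7_heegnerPoint_conj_add_eq_card_smul (hF : IsImaginaryQuadratic F) {N : ℕ} [NeZero N]
    (hN : cm7.conductorNorm ℤ = N) (hH : SatisfiesHeegnerHypothesis N F) (D₀ : ModularParametrizationData cm7 N)
    (hw : cm7.rootNumber = 1) (H : HeegnerDatum N (NumberField.discr F)) (ι : F →+* ℂ)
    {P : (cm7.baseChange F).toAffine.Point} (hP : Affine.Point.map ι.toRatAlgHom P = heegnerPointComplex D₀ H)
    {σ : F →ₐ[ℚ] F} (hσ : σ ≠ AlgHom.id ℚ F) :
    Affine.Point.map ι.toRatAlgHom (Affine.Point.map σ P + P) = H.reps.card • D₀.cuspZeroPoint := by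
  subst hN
  have hW : IsFrickeEigen (cm7.conductorNorm ℤ) D₀.f (((-1 : ℤ)) : ℂ) := by
    push_cast
    exact isFrickeEigen_neg_one_of_rootNumber_eq_one cm7 D₀.isNewformOf hw
  have hlaw := conjPoint_sum_φ_heegnerTau_filter hF hH D₀ H hW (Or.inr rfl) (fun _ ↦ True) (fun _ ↦ Iff.rfl)
  simp only [Finset.filter_true] at hlaw
  -- `ι (σ P) = conj (ι P)`
  have hισ : Affine.Point.map (W' := cm7) ι.toRatAlgHom (Affine.Point.map (W' := cm7) σ P) =
      conjPoint cm7 (heegnerPointComplex D₀ H) := by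
    have hcomp : ι.toRatAlgHom.comp σ = conjRatAlgHom.comp ι.toRatAlgHom := by
      apply AlgHom.ext
      intro x
      have := RingHom.congr_fun (comp_eq_conjugate_of_ne_id hF ι hσ) x
      simpa using this
    rw [Affine.Point.map_map, ← hP]
    change _ = Affine.Point.map (W' := cm7) conjRatAlgHom (Affine.Point.map (W' := cm7) ι.toRatAlgHom P)
    rw [Affine.Point.map_map, hcomp]
  rw [map_add, hισ, hP]
  change conjPoint cm7 (∑ Q ∈ H.reps, D₀.φ (heegnerTau Q)) + ∑ Q ∈ H.reps, D₀.φ (heegnerTau Q) = _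
  rw [hlaw, neg_one_zsmul, neg_one_zsmul, sub_neg_eq_add, neg_add_cancel_comm]

/-- **Birch's relation `σP + P = T` in `X₀(49)(F)`**, granted `φ(0) = T` (the named input (T-φ0), verbatim shape) and `h_F` odd:
`ι(σP + P) = h_F·T = T` and `E(F) ↪ E(ℂ)`. [cite: Gross1984, §5 (5.2)–(5.3)] [cite: GrossLMS1991, Prop. 5.3] -/
theorem cm7_heegnerPoint_conj_add_eq_twoTorsion (hF : IsImaginaryQuadratic F) {N : ℕ} [NeZero N]
    (hN : cm7.conductorNorm ℤ = N) (hH : SatisfiesHeegnerHypothesis N F) (D₀ : ModularParametrizationData cm7 N)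
    (hw : cm7.rootNumber = 1) (h0 : ∃ h, D₀.cuspZeroPoint = Affine.Point.some 2 (-1) h)
    (H : HeegnerDatum N (NumberField.discr F)) (hodd : Odd H.reps.card) (ι : F →+* ℂ)
    {P : (cm7.baseChange F).toAffine.Point} (hP : Affine.Point.map ι.toRatAlgHom P = heegnerPointComplex D₀ H)
    {σ : F →ₐ[ℚ] F} (hσ : σ ≠ AlgHom.id ℚ F) :
    Affine.Point.map σ P + P = Affine.Point.some 2 (-1) (nonsingular_cm7_baseChange_two_neg_one F) := by
  apply Affine.Point.map_injective (f := ι.toRatAlgHom)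
  have hT : Affine.Point.map (W' := cm7) ι.toRatAlgHom (Affine.Point.some 2 (-1) (nonsingular_cm7_baseChange_two_neg_one F)) =
      Affine.Point.some 2 (-1) (nonsingular_cm7_baseChange_two_neg_one ℂ) := by
    rw [Affine.Point.map_some]
    congr 1
    · exact map_ofNat ι.toRatAlgHom 2
    · rw [map_neg, map_one]
  rw [map_cm7_heegnerPoint_conj_add_eq_card_smul hF hN hH D₀ hw H ι hP hσ, hT]
  obtain ⟨h, hh⟩ := h0
  have hh' : D₀.cuspZeroPoint = Affine.Point.some 2 (-1) (nonsingular_cm7_baseChange_two_neg_one ℂ) := hh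
  rw [hh', ← natCast_zsmul]
  exact zsmul_eq_self_of_odd_of_add_self_eq_zero (cm7_twoTorsion_add_self ℂ) hodd.natCast

end Birch

/-! ## §2 The partner field `K₂ = ℚ⟮r₀⟯ ⊂ K[1]` and the partner point -/

section Partner

variable {K : Type} [Field K] [NumberField K]

/-- `−ℓ` is not a square in `ℚ`. [folklore] -/
theorem not_isSquare_neg_natCast_rat {l : ℕ} (hl : l.Prime) : ¬ IsSquare (-(l : ℚ)) := by
  rintro ⟨b, hb⟩
  have : (0 : ℚ) < l := by exact_mod_cast hl.pos
  nlinarith [mul_self_nonneg b]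

/-- A complex number with `z² = −ℓ < 0` is purely imaginary: `conj z = −z`. [folklore] -/
theorem conj_eq_neg_of_sq_eq_neg {z : ℂ} {l : ℕ} (hl : l.Prime) (hz : z ^ 2 = -(l : ℂ)) :
    starRingEnd ℂ z = -z := by
  have hsq : (starRingEnd ℂ z) ^ 2 = z ^ 2 := by rw [← map_pow, hz, map_neg, map_natCast]
  rcases sq_eq_sq_iff_eq_or_eq_neg.mp hsq with h | h
  · exfalso
    have hre : (z.re : ℂ) = z := Complex.conj_eq_iff_re.mp h
    have h1 : ((z.re ^ 2 : ℝ) : ℂ) = -(l : ℂ) := by push_cast; rw [hre, hz]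
    have h2 : (z.re ^ 2 : ℝ) = -(l : ℝ) := by exact_mod_cast h1
    have : (0 : ℝ) < l := by exact_mod_cast hl.pos
    nlinarith [sq_nonneg z.re]
  · exact h

variable (ι : K →+* ℂ)

/-- `r₀² = −ℓ` read in `K[1]` over `ℚ`. [folklore] -/
theorem sq_eq_algebraMap_neg_of_coe_sq {l : ℕ} {r₀ : ringClassField K ι 1} (hr : (r₀ : ℂ) ^ 2 = -(l : ℂ)) :
    r₀ ^ 2 = algebraMap ℚ (ringClassField K ι 1) (-(l : ℚ)) := by
  apply Subtype.ext
  rw [map_neg, map_natCast]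
  push_cast
  exact hr

/-- `[ℚ⟮r₀⟯ : ℚ] = 2` for `r₀² = −ℓ`. [folklore] -/
theorem finrank_adjoin_sqrt_neg_prime [NumberField (ringClassField K ι 1)] {l : ℕ} (hl : l.Prime) {r₀ : ringClassField K ι 1}
    (hr : (r₀ : ℂ) ^ 2 = -(l : ℂ)) : Module.finrank ℚ ℚ⟮r₀⟯ = 2 :=
  finrank_adjoin_sqrt_eq_two (k := ℚ) (sq_eq_algebraMap_neg_of_coe_sq ι hr) (not_isSquare_neg_natCast_rat hl)

/-- The generator `r₀ ∈ ℚ⟮r₀⟯` squares to `−ℓ`. [folklore] -/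
theorem adjoinGen_sq {l : ℕ} {r₀ : ringClassField K ι 1} (hr : (r₀ : ℂ) ^ 2 = -(l : ℂ)) :
    (⟨r₀, IntermediateField.mem_adjoin_simple_self ℚ r₀⟩ : ℚ⟮r₀⟯) ^ 2 = -(l : ℚ⟮r₀⟯) := by
  apply Subtype.ext
  apply Subtype.ext
  push_cast
  exact hr

/-- `ℚ⟮r₀⟯` is imaginary quadratic. [cite: Cox2013, §5.B (p. 119)] -/
theorem isImaginaryQuadratic_adjoin_sqrt_neg_prime [NumberField (ringClassField K ι 1)] {l : ℕ} (hl : l.Prime) {r₀ : ringClassField K ι 1}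
    (hr : (r₀ : ℂ) ^ 2 = -(l : ℂ)) : IsImaginaryQuadratic (ℚ⟮r₀⟯ : IntermediateField ℚ (ringClassField K ι 1)) := by
  refine IsImaginaryQuadratic.of_quadratic (finrank_adjoin_sqrt_neg_prime ι hl hr)
    (θ := ⟨r₀, IntermediateField.mem_adjoin_simple_self ℚ r₀⟩) (u := 0) (v := l) ?_ (by
      have : (0 : ℚ) < l := by exact_mod_cast hl.pos
      nlinarith)
  rw [adjoinGen_sq ι hr, map_zero, zero_mul, add_zero, map_natCast, neg_add_cancel]

/-- `d(ℚ⟮r₀⟯) = −ℓ` for `ℓ ≡ 3 (mod 4)`. [cite: Cox2013, (2.21)] -/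
theorem discr_adjoin_sqrt_neg_prime [NumberField (ringClassField K ι 1)] {l : ℕ} (hl : l.Prime) (hl4 : l % 4 = 3) {r₀ : ringClassField K ι 1}
    (hr : (r₀ : ℂ) ^ 2 = -(l : ℂ)) :
    NumberField.discr (ℚ⟮r₀⟯ : IntermediateField ℚ (ringClassField K ι 1)) = -(l : ℤ) :=
  discr_eq_neg_prime_of_sq_eq (finrank_adjoin_sqrt_neg_prime ι hl hr) hl hl4 (adjoinGen_sq ι hr)

/-- `h(ℚ⟮r₀⟯) = h(−ℓ)` is odd. [cite: Cox2013, Prop. 3.11 / Thm. 6.1] -/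
theorem odd_classNumber_adjoin_sqrt_neg_prime [NumberField (ringClassField K ι 1)] {l : ℕ} (hl : l.Prime) (hl4 : l % 4 = 3) {r₀ : ringClassField K ι 1}
    (hr : (r₀ : ℂ) ^ 2 = -(l : ℂ)) :
    Odd (NumberField.classNumber (ℚ⟮r₀⟯ : IntermediateField ℚ (ringClassField K ι 1))) :=
  odd_classNumber_of_sq_eq_neg_prime (finrank_adjoin_sqrt_neg_prime ι hl hr) hl hl4 (adjoinGen_sq ι hr)

/-- `7` splits in `ℚ(√−ℓ)` when `(ℓ/7) = −1`: the Heegner hypothesis for `49`. [cite: Gross1984, §3 (Heegner hypothesis)] -/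
theorem satisfiesHeegnerHypothesis_adjoin_sqrt_neg_prime [NumberField (ringClassField K ι 1)] {l : ℕ} (hl : l.Prime) (hl4 : l % 4 = 3)
    (hl7 : jacobiSym l 7 = -1) {r₀ : ringClassField K ι 1} (hr : (r₀ : ℂ) ^ 2 = -(l : ℂ)) {N : ℕ}
    (hN : cm7.conductorNorm ℤ = N) :
    SatisfiesHeegnerHypothesis N (ℚ⟮r₀⟯ : IntermediateField ℚ (ringClassField K ι 1)) := by
  subst hN
  rw [conductorNorm_cm7, satisfiesHeegnerHypothesis_iff_kronecker 49 _ (finrank_adjoin_sqrt_neg_prime ι hl hr)]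
  intro p hp hp49
  have hp7 : p = 7 := by
    have h : p ∣ 7 ^ 2 := by simpa using hp49
    exact (Nat.prime_dvd_prime_iff_eq hp (by norm_num)).mp (hp.dvd_of_dvd_pow h)
  subst hp7
  refine ⟨fun h ↦ by omega, fun _ ↦ ?_⟩
  rw [discr_adjoin_sqrt_neg_prime ι hl hl4 hr, jacobiSym.neg _ (by decide), ZMod.χ₄_nat_three_mod_four (by norm_num), hl7]
  norm_num

/-- A `ℚ`-algebra map of `K[1]` fixing `r₀` is the identity on `ℚ⟮r₀⟯`. [folklore] -/
theorem algHom_comp_val_eq_of_apply_eq {r₀ : ringClassField K ι 1}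
    (t : ringClassField K ι 1 →ₐ[ℚ] ringClassField K ι 1) (ht : t r₀ = r₀) :
    t.comp (ℚ⟮r₀⟯).val = (ℚ⟮r₀⟯).val := by
  refine IntermediateField.adjoin_algHom_ext ℚ (fun x hx ↦ ?_)
  rw [Set.mem_singleton_iff] at hx
  subst hx
  simpa using ht

/-- A `ℚ`-algebra map of `K[1]` with `t r₀ = −r₀` restricts on `ℚ⟮r₀⟯` to the automorphism `c` with `c r₀ = −r₀`. [folklore] -/
theorem algHom_comp_val_eq_of_apply_eq_neg {r₀ : ringClassField K ι 1}
    (t : ringClassField K ι 1 →ₐ[ℚ] ringClassField K ι 1) (ht : t r₀ = -r₀)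
    (c : ℚ⟮r₀⟯ →ₐ[ℚ] ℚ⟮r₀⟯)
    (hc : c ⟨r₀, IntermediateField.mem_adjoin_simple_self ℚ r₀⟩ = -⟨r₀, IntermediateField.mem_adjoin_simple_self ℚ r₀⟩) :
    t.comp (ℚ⟮r₀⟯).val = (ℚ⟮r₀⟯).val.comp c := by
  refine IntermediateField.adjoin_algHom_ext ℚ (fun x hx ↦ ?_)
  rw [Set.mem_singleton_iff] at hx
  subst hx
  change t ((ℚ⟮x⟯).val ⟨x, _⟩) = (ℚ⟮x⟯).val (c ⟨x, _⟩)
  rw [hc, map_neg]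
  simpa using ht

-- One decidability world for the point groups over `K[1]` and `ℚ⟮r₀⟯` (the assembly's and the Literature facts'
-- `Classical.propDecidable`, not `Subtype.instDecidableEq`); file-local, cannot leak to importers. The arithmetic
-- lemmas above stay in the default world (`decide`/`omega` need it).
attribute [local instance 2000] Classical.propDecidable

/-- **The partner point (hypotheses (H2)–(H4) of the half-trace assembly, discharged).** For `d_K = −8ℓ` data as in the
assembly and `r₀ ∈ K[1]`, `r₀² = −ℓ`: with `K₂ = ℚ⟮r₀⟯ ⊂ K[1]` there are a Heegner datum `H₂` and a Heegner point
`P₂ ∈ X₀(49)(K₂)` over `Σ_Q φ(τ_Q)` such that `Y := P₂ ∈ X₀(49)(K[1])` is fixed by every `ℚ`-algebra map of `K[1]` fixing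
`r₀` and satisfies `Y + tY = T` for every one with `t r₀ = −r₀` (in particular for complex conjugation and for the
`σ ∈ Gal(K[1]/K)` off the genus subgroup). Inputs BY NAME: `w(49a1) = +1` (`hw`) and (T-φ0) (`h0`, verbatim shape).
[cite: Gross1984, §5 (5.2)–(5.3)] [cite: GrossLMS1991, Prop. 5.3] [cite: Darmon2004, Thm. 3.6 and Prop. 3.11] -/
theorem exists_partnerPoint_negEightPrime [NumberField (ringClassField K ι 1)] (hw : cm7.rootNumber = 1) {l : ℕ} (hl : l.Prime) (hl4 : l % 4 = 3)
    (hl7 : jacobiSym l 7 = -1) {N : ℕ} [NeZero N] (hN : cm7.conductorNorm ℤ = N) (D₀ : ModularParametrizationData cm7 N)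
    (h0 : ∃ h, D₀.cuspZeroPoint = Affine.Point.some 2 (-1) h)
    {r₀ : ringClassField K ι 1} (hr : (r₀ : ℂ) ^ 2 = -(l : ℂ)) :
    ∃ (H₂ : HeegnerDatum N (NumberField.discr (ℚ⟮r₀⟯ : IntermediateField ℚ (ringClassField K ι 1))))
      (P₂ : (cm7.baseChange (ℚ⟮r₀⟯ : IntermediateField ℚ (ringClassField K ι 1))).toAffine.Point),
      Affine.Point.map ((ringClassField K ι 1).subtype.comp (algebraMap ℚ⟮r₀⟯ (ringClassField K ι 1))).toRatAlgHom P₂ =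
          heegnerPointComplex D₀ H₂ ∧
      (∀ t : ringClassField K ι 1 →ₐ[ℚ] ringClassField K ι 1, t r₀ = r₀ →
        Affine.Point.map t (Affine.Point.map (ℚ⟮r₀⟯).val P₂) = Affine.Point.map (ℚ⟮r₀⟯).val P₂) ∧
      (∀ t : ringClassField K ι 1 →ₐ[ℚ] ringClassField K ι 1, t r₀ = -r₀ →
        Affine.Point.map (ℚ⟮r₀⟯).val P₂ + Affine.Point.map t (Affine.Point.map (ℚ⟮r₀⟯).val P₂) =
          Affine.Point.some 2 (-1) (nonsingular_cm7_baseChange_two_neg_one (ringClassField K ι 1))) := by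
  have hK₂ := isImaginaryQuadratic_adjoin_sqrt_neg_prime ι hl hr
  have hH₂ := satisfiesHeegnerHypothesis_adjoin_sqrt_neg_prime ι hl hl4 hl7 hr hN
  obtain ⟨β₂, hβ₂⟩ := exists_dvd_sq_sub_discr_holds N _ hK₂ hH₂
  obtain ⟨H₂, -⟩ := nonempty_heegnerDatum_holds N _ hK₂ hβ₂
  set ι₂ : (ℚ⟮r₀⟯ : IntermediateField ℚ (ringClassField K ι 1)) →+* ℂ :=
    (ringClassField K ι 1).subtype.comp (algebraMap ℚ⟮r₀⟯ (ringClassField K ι 1)) with hι₂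
  obtain ⟨P₂, hP₂⟩ := heegnerPointComplex_mem_range_map_holds N cm7 _ hK₂ hH₂ D₀ H₂ ι₂
  have hodd : Odd H₂.reps.card := by
    rw [HeegnerDatum.card_reps_eq_classNumber_holds N _ hK₂ hH₂ H₂]
    exact odd_classNumber_adjoin_sqrt_neg_prime ι hl hl4 hr
  refine ⟨H₂, P₂, hP₂, fun t ht ↦ ?_, fun t ht ↦ ?_⟩
  · rw [Affine.Point.map_map, algHom_comp_val_eq_of_apply_eq ι t ht]
  · -- the non-trivial automorphism `c` of `K₂`, `c r₀ = −r₀`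
    have hθ : (⟨r₀, IntermediateField.mem_adjoin_simple_self ℚ r₀⟩ : ℚ⟮r₀⟯) ∉
        Set.range (algebraMap ℚ (ℚ⟮r₀⟯ : IntermediateField ℚ (ringClassField K ι 1))) := by
      rintro ⟨q, hq⟩
      have h5 : q ^ 2 = -(l : ℚ) := by
        apply (algebraMap ℚ (ℚ⟮r₀⟯ : IntermediateField ℚ (ringClassField K ι 1))).injective
        rw [map_pow, hq, map_neg, map_natCast]
        exact adjoinGen_sq ι hr
      have : (0 : ℚ) < l := by exact_mod_cast hl.pos
      nlinarith [sq_nonneg q]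
    have hc2 : (⟨r₀, IntermediateField.mem_adjoin_simple_self ℚ r₀⟩ : ℚ⟮r₀⟯) ^ 2 =
        algebraMap ℚ (ℚ⟮r₀⟯ : IntermediateField ℚ (ringClassField K ι 1)) (-(l : ℚ)) := by
      rw [adjoinGen_sq ι hr, map_neg, map_natCast]
    set c := Literature.NumberTheory.QuadraticFields.Quadratic.conj (finrank_adjoin_sqrt_neg_prime ι hl hr) hθ hc2 with hc_def
    have hcr : c ⟨r₀, IntermediateField.mem_adjoin_simple_self ℚ r₀⟩ =
        -⟨r₀, IntermediateField.mem_adjoin_simple_self ℚ r₀⟩ :=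
      Literature.NumberTheory.QuadraticFields.Quadratic.conj_gen _ hθ hc2
    have hcne : c ≠ AlgHom.id ℚ _ := by
      intro h
      have h1 := congrArg (fun f : (ℚ⟮r₀⟯ : IntermediateField ℚ (ringClassField K ι 1)) →ₐ[ℚ] ℚ⟮r₀⟯ ↦
        f ⟨r₀, IntermediateField.mem_adjoin_simple_self ℚ r₀⟩) h
      simp only [AlgHom.id_apply] at h1
      rw [h1] at hcr
      have h2 : (⟨r₀, IntermediateField.mem_adjoin_simple_self ℚ r₀⟩ : ℚ⟮r₀⟯) = 0 := by
        have h2' := add_eq_zero_iff_eq_neg.mpr hcr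
        rw [← two_mul] at h2'
        exact (mul_eq_zero.mp h2').resolve_left two_ne_zero
      have h3 := adjoinGen_sq ι hr
      rw [h2, zero_pow two_ne_zero] at h3
      have : (l : (ℚ⟮r₀⟯ : IntermediateField ℚ (ringClassField K ι 1))) ≠ 0 := by exact_mod_cast hl.ne_zero
      exact this (neg_eq_zero.mp h3.symm)
    have hB := cm7_heegnerPoint_conj_add_eq_twoTorsion hK₂ hN hH₂ D₀ hw h0 H₂ hodd ι₂ hP₂ hcne
    have hT : Affine.Point.map (W' := cm7) (ℚ⟮r₀⟯).val
        (Affine.Point.some 2 (-1) (nonsingular_cm7_baseChange_two_neg_one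
          (ℚ⟮r₀⟯ : IntermediateField ℚ (ringClassField K ι 1)))) =
        Affine.Point.some 2 (-1) (nonsingular_cm7_baseChange_two_neg_one (ringClassField K ι 1)) := by
      rw [Affine.Point.map_some]
      congr 1
    have hmm : Affine.Point.map (W' := cm7) (ℚ⟮r₀⟯).val (Affine.Point.map (W' := cm7) c P₂) =
        Affine.Point.map (W' := cm7) ((ℚ⟮r₀⟯).val.comp c) P₂ := by
      cases P₂ <;> rfl
    have hB' := congrArg (Affine.Point.map (W' := cm7) (ℚ⟮r₀⟯).val) hB
    rw [map_add, hmm, hT] at hB'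
    rw [Affine.Point.map_map, algHom_comp_val_eq_of_apply_eq_neg ι t ht c hcr, add_comm]
    exact hB'

end Partner

end Summit.BirchSwinnertonDyer.BirchSwinnertonDyer.Theorems.GoldfeldGoodTwists

end
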